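import Summits.CriticalPhenomena.PercolationContinuityZ3.Theorems.PercNearOneGluingAdditiveGluingSetObserverCoreS
import HarnessLib

/-!
# Sandwich BHK for a SET observer — IV: Corollary H (conditional sandwich association) for an observer set

Crux `PercNearOneGluing.AdditiveGluing` (stmt-CriticalPhenomena-4576), stub `stub_goodStep` (stub-plan prover; towards
the two-relay drift theorem = `stub_blockGoodTwo` at `A.card = 3`).  Set-observer versions of seat k41's Corollary H
(`sandwich_condAssoc`, `…SandwichLemma3.lean`), from Theorem S for an observer set (part III) with `U = univ`,
`X = Y = {t}`.  Lands `--supports` the crux; no definitions, no named facts.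

For vertices `s, t`, an observer SET `O` with `K_O = ⋃_{o∈O} C_o`, an increasing `F` and an ARBITRARY
`h : Set (Sym2 V) → [0,1]`, given `D = {s ↮ t}`:
* `sandwich_condAssoc_set`: `F(C_s)` and `g = 1{s ↔ O} + 1{s ↮ O} 1{O ↮ t} h(K_O)` are positively correlated on `D`;
* `sandwich_condAssoc_set_hat`: `F(C_s)` and `ĝ = 1{O ↮ t} (1{s ↔ O} + 1{s ↮ O} h(K_O))` are positively correlated on `D`;
both in the denominator-free form `(∫_D F)(∫_D g) ≤ μ(D) ∫_D F g`, `μ = prodBernoulli w`.  For a point observer the two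
coincide on `D` (k41); for a set they differ on `{s ↔ O ↔ t, s ↮ t}`, and Kozma–Nitzan's Lemma 3 for a set observer
(part V) needs both: `ĝ` represents the indicator of a sandwich event, `g` its complement.
[cite: VandenbergHaggstromKahn2005, Thms. 1.1–1.5 (pp. 3–8)]
-/

noncomputable section

open MeasureTheory unitInterval
open Literature.Probability.LatticeModels (prodBernoulli)
open Literature.Probability.Percolation
open Literature.Probability.Percolation.BHK2006

namespace Summit.CriticalPhenomena.PercolationContinuityZ3.Theorems

namespace SandwichSet

open scoped Classical
open DecisionTree (ind ind_of_mem ind_of_not_mem ind_nonneg)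
open SandwichK41

variable {V : Type*} [Fintype V]

/-- From a Theorem-S-type inequality at `U = univ`, `X = Y = {t}` for the shifted `F − F ∅` to the integral form of
conditional association on `D = {s ↮ t}` (bookkeeping shared by the two corollaries). [folklore] -/
theorem condAssoc_of_coreS (w : Sym2 V → unitInterval) (s t : V) (F : Set (Sym2 V) → ℝ)
    (gg : BondConfig V → ℝ) (g : V → Finset V → Set V → Set (Sym2 V) → ℝ)
    (hgt : ∀ ω, g s Finset.univ ({t} : Set V) ω = gg ω)
    (hS : ∀ (w' : Sym2 V → ℝ), (∀ e, 0 ≤ w' e) → (∀ e, w' e ≤ 1) → ∑ ω, weight w' ω = 1 →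
      (∑ ω, weight w' ω * ((F (rC Finset.univ s ω) - F ∅) * ind (rD Finset.univ s ({t} : Set V)) ω)) *
        (∑ ω, weight w' ω * (g s Finset.univ ({t} : Set V) ω * ind (rD Finset.univ s ({t} : Set V)) ω)) ≤
      (∑ ω, weight w' ω * ((F (rC Finset.univ s ω) - F ∅) * g s Finset.univ (({t} : Set V) ∩ {t}) ω *
          ind (rD Finset.univ s (({t} : Set V) ∩ {t})) ω)) *
        (∑ ω, weight w' ω * ind (rD Finset.univ s (({t} : Set V) ∪ {t})) ω)) :
    (∫ ω in {ω : BondConfig V | ¬ (openGraph ω).Reachable s t}, F (openEdgeCluster ω s) ∂(prodBernoulli w)) *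
      (∫ ω in {ω : BondConfig V | ¬ (openGraph ω).Reachable s t}, gg ω ∂(prodBernoulli w)) ≤
    (prodBernoulli w).real {ω : BondConfig V | ¬ (openGraph ω).Reachable s t} *
      ∫ ω in {ω : BondConfig V | ¬ (openGraph ω).Reachable s t}, F (openEdgeCluster ω s) * gg ω
        ∂(prodBernoulli w) := by
  set D : Set (BondConfig V) := {ω | ¬ (openGraph ω).Reachable s t} with hD
  have hDm : MeasurableSet D := MeasurableSet.of_discrete
  set w' : Sym2 V → ℝ := fun e => (w e : ℝ) with hw'
  have hw0 : ∀ e, 0 ≤ w' e := fun e => (w e).2.1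
  have hw1 : ∀ e, w' e ≤ 1 := fun e => (w e).2.2
  have hint : ∀ k : Set (Sym2 V) → ℝ,
      ∫ ω in D, k ω ∂(prodBernoulli w) = ∑ ω, weight w' ω * (k ω * ind D ω) := by
    intro k
    rw [← integral_indicator hDm, integral_prodBernoulli_eq_sum]
    refine Finset.sum_congr rfl fun ω _ => ?_
    by_cases hω : ω ∈ D
    · rw [Set.indicator_of_mem hω, ind_of_mem hω, mul_one]
    · rw [Set.indicator_of_notMem hω, ind_of_not_mem hω]; ring
  have hreal : (prodBernoulli w).real D = ∑ ω, weight w' ω * ind D ω := by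
    rw [← integral_indicator_one hDm, integral_prodBernoulli_eq_sum]
    refine Finset.sum_congr rfl fun ω _ => ?_
    by_cases hω : ω ∈ D
    · rw [Set.indicator_of_mem hω, ind_of_mem hω, Pi.one_apply]
    · rw [Set.indicator_of_notMem hω, ind_of_not_mem hω, mul_zero]
  have hm : ∑ ω, weight w' ω = 1 := by
    have e := integral_prodBernoulli_eq_sum w fun _ => (1 : ℝ)
    simp only [integral_const, probReal_univ, smul_eq_mul, mul_one] at e
    exact e.symm
  have hE : ∀ ω : Set (Sym2 V), ω ∩ edgesIn (Finset.univ : Finset V) = ω := fun ω => by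
    ext e
    simp only [Set.mem_inter_iff, edgesIn, Set.mem_setOf_eq, Finset.mem_univ, imp_true_iff, and_true]
  have hC : ∀ (v : V) ω, rC Finset.univ v ω = openEdgeCluster ω v := fun v ω => by
    simp only [rC, hE]
  have hDD : rD Finset.univ s ({t} : Set V) = D := by
    ext ω
    simp only [rD, hE, hD, Set.mem_setOf_eq, Set.mem_singleton_iff, forall_eq]
  have key := hS w' hw0 hw1 hm
  rw [Set.inter_self, Set.union_self] at key
  simp only [hC, hDD, hgt] at key
  set P := ∑ ω, weight w' ω * ind D ω with hP
  set Ef := ∑ ω, weight w' ω * (F (openEdgeCluster ω s) * ind D ω) with hEf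
  set Eg := ∑ ω, weight w' ω * (gg ω * ind D ω) with hEg
  set Efg := ∑ ω, weight w' ω * (F (openEdgeCluster ω s) * gg ω * ind D ω) with hEfg
  have x1 : ∑ ω, weight w' ω * ((F (openEdgeCluster ω s) - F ∅) * ind D ω) = Ef - F ∅ * P := by
    have := sum_affine w' (fun ω => (F (openEdgeCluster ω s) - F ∅) * ind D ω)
      (fun ω => F (openEdgeCluster ω s) * ind D ω) (ind D) (ind D) (ind D) 1 (-F ∅) 0 0
      (fun ω => by ring)
    rw [this]; ring
  have x3 : ∑ ω, weight w' ω * ((F (openEdgeCluster ω s) - F ∅) * gg ω * ind D ω) =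
      Efg - F ∅ * Eg := by
    have := sum_affine w' (fun ω => (F (openEdgeCluster ω s) - F ∅) * gg ω * ind D ω)
      (fun ω => F (openEdgeCluster ω s) * gg ω * ind D ω) (fun ω => gg ω * ind D ω) (ind D) (ind D)
      1 (-F ∅) 0 0 (fun ω => by ring)
    rw [this]; ring
  rw [x1, x3] at key
  rw [hint, hint, hint (fun ω => F (openEdgeCluster ω s) * gg ω), hreal]
  show Ef * Eg ≤ P * Efg
  nlinarith [key]

/-- `U = univ`: reachability and clusters inside `univ` are the plain ones. [folklore] -/
theorem inter_edgesIn_univ (ω : Set (Sym2 V)) : ω ∩ edgesIn (Finset.univ : Finset V) = ω := by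
  ext e
  simp only [Set.mem_inter_iff, edgesIn, Set.mem_setOf_eq, Finset.mem_univ, imp_true_iff, and_true]

/-- **Corollary H for an observer SET.**  Given `D = {s ↮ t}`, the increasing cluster function `F(C_s)` and the set
sandwich function `g = 1{s ↔ O} + 1{s ↮ O} · 1{O ↮ t} · h(K_O)` (ARBITRARY `h : · → [0,1]`) are positively correlated:
`(∫_D F(C_s) dμ)(∫_D g dμ) ≤ μ(D) ∫_D F(C_s) g dμ`.  Theorem S for an observer set (`coreS_set`) with `U = univ`,
`X = Y = {t}`, `F` shifted by `F ∅`. [cite: VandenbergHaggstromKahn2005, Thms. 1.1–1.5 (pp. 3–8)] -/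
theorem sandwich_condAssoc_set (w : Sym2 V → unitInterval) (s t : V) (O : Finset V)
    (F : Set (Sym2 V) → ℝ) (hF : Monotone F) (h : Set (Sym2 V) → ℝ) (h0 : ∀ C, 0 ≤ h C)
    (h1 : ∀ C, h C ≤ 1) :
    (∫ ω in {ω : BondConfig V | ¬ (openGraph ω).Reachable s t},
        F (openEdgeCluster ω s) ∂(prodBernoulli w)) *
      (∫ ω in {ω : BondConfig V | ¬ (openGraph ω).Reachable s t},
        (if ∃ o ∈ O, (openGraph ω).Reachable s o then (1 : ℝ)
          else if ∃ o ∈ O, (openGraph ω).Reachable o t then 0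
            else h (⋃ o ∈ O, openEdgeCluster ω o)) ∂(prodBernoulli w)) ≤
    (prodBernoulli w).real {ω : BondConfig V | ¬ (openGraph ω).Reachable s t} *
      ∫ ω in {ω : BondConfig V | ¬ (openGraph ω).Reachable s t},
        F (openEdgeCluster ω s) *
          (if ∃ o ∈ O, (openGraph ω).Reachable s o then (1 : ℝ)
            else if ∃ o ∈ O, (openGraph ω).Reachable o t then 0
              else h (⋃ o ∈ O, openEdgeCluster ω o)) ∂(prodBernoulli w) := by
  set g : V → Finset V → Set V → Set (Sym2 V) → ℝ := fun s' U T ω =>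
    if ∃ o ∈ O, (openGraph (ω ∩ edgesIn U)).Reachable s' o then (1 : ℝ)
      else h (⋃ o ∈ O, rC U o ω) * ind (⋂ o ∈ O, rD U o T) ω with hgdef
  refine condAssoc_of_coreS w s t F _ g (fun ω => ?_) fun w' hw0 hw1 hm =>
    coreS_set w' hw0 hw1 hm O h h0 h1 g (fun _ _ _ _ => rfl) Finset.univ s (Finset.mem_univ s)
      {t} {t} (by simp) (by simp) (fun a => F a - F ∅) (fun a b hab => sub_le_sub_right (hF hab) _)
      (fun a => sub_nonneg.2 (hF (Set.empty_subset a)))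
  simp only [hgdef, rC, inter_edgesIn_univ]
  by_cases hso : ∃ o ∈ O, (openGraph ω).Reachable s o
  · rw [if_pos hso, if_pos hso]
  · rw [if_neg hso, if_neg hso]
    by_cases hot : ∃ o ∈ O, (openGraph ω).Reachable o t
    · rw [if_pos hot, ind_of_not_mem]
      · ring
      · intro hω
        obtain ⟨o, ho, hr⟩ := hot
        exact (Set.mem_iInter₂.1 hω o ho) t rfl (by simpa only [inter_edgesIn_univ] using hr)
    · rw [if_neg hot, ind_of_mem, mul_one]
      simp only [Set.mem_iInter]
      intro o ho x hx
      rw [Set.mem_singleton_iff] at hx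
      subst hx
      rw [inter_edgesIn_univ]
      exact fun hr => hot ⟨o, ho, hr⟩

/-- **Corollary H for an observer SET, cut sandwich function.**  Given `D = {s ↮ t}`, `F(C_s)` (increasing) and
`ĝ = 1{O ↮ t} · (1{s ↔ O} + 1{s ↮ O} h(K_O))` (ARBITRARY `h : · → [0,1]`) are positively correlated:
`(∫_D F(C_s) dμ)(∫_D ĝ dμ) ≤ μ(D) ∫_D F(C_s) ĝ dμ` (`coreS_set_hat` with `U = univ`, `X = Y = {t}`).
[cite: VandenbergHaggstromKahn2005, Thms. 1.1–1.5 (pp. 3–8)] -/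
theorem sandwich_condAssoc_set_hat (w : Sym2 V → unitInterval) (s t : V) (O : Finset V)
    (F : Set (Sym2 V) → ℝ) (hF : Monotone F) (h : Set (Sym2 V) → ℝ) (h0 : ∀ C, 0 ≤ h C)
    (h1 : ∀ C, h C ≤ 1) :
    (∫ ω in {ω : BondConfig V | ¬ (openGraph ω).Reachable s t},
        F (openEdgeCluster ω s) ∂(prodBernoulli w)) *
      (∫ ω in {ω : BondConfig V | ¬ (openGraph ω).Reachable s t},
        (if ∃ o ∈ O, (openGraph ω).Reachable o t then (0 : ℝ)
          else if ∃ o ∈ O, (openGraph ω).Reachable s o then 1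
            else h (⋃ o ∈ O, openEdgeCluster ω o)) ∂(prodBernoulli w)) ≤
    (prodBernoulli w).real {ω : BondConfig V | ¬ (openGraph ω).Reachable s t} *
      ∫ ω in {ω : BondConfig V | ¬ (openGraph ω).Reachable s t},
        F (openEdgeCluster ω s) *
          (if ∃ o ∈ O, (openGraph ω).Reachable o t then (0 : ℝ)
            else if ∃ o ∈ O, (openGraph ω).Reachable s o then 1
              else h (⋃ o ∈ O, openEdgeCluster ω o)) ∂(prodBernoulli w) := by
  set g : V → Finset V → Set V → Set (Sym2 V) → ℝ := fun s' U T ω =>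
    ind (⋂ o ∈ O, rD U o T) ω *
      (if ∃ o ∈ O, (openGraph (ω ∩ edgesIn U)).Reachable s' o then (1 : ℝ) else h (⋃ o ∈ O, rC U o ω))
    with hgdef
  refine condAssoc_of_coreS w s t F _ g (fun ω => ?_) fun w' hw0 hw1 hm =>
    coreS_set_hat w' hw0 hw1 hm O h h0 h1 g (fun _ _ _ _ => rfl) Finset.univ s (Finset.mem_univ s)
      {t} {t} (by simp) (by simp) (fun a => F a - F ∅) (fun a b hab => sub_le_sub_right (hF hab) _)
      (fun a => sub_nonneg.2 (hF (Set.empty_subset a)))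
  simp only [hgdef, rC, inter_edgesIn_univ]
  by_cases hot : ∃ o ∈ O, (openGraph ω).Reachable o t
  · rw [if_pos hot, ind_of_not_mem, zero_mul]
    intro hω
    obtain ⟨o, ho, hr⟩ := hot
    exact (Set.mem_iInter₂.1 hω o ho) t rfl (by simpa only [inter_edgesIn_univ] using hr)
  · rw [if_neg hot, ind_of_mem, one_mul]
    simp only [Set.mem_iInter]
    intro o ho x hx
    rw [Set.mem_singleton_iff] at hx
    subst hx
    rw [inter_edgesIn_univ]
    exact fun hr => hot ⟨o, ho, hr⟩

end SandwichSet

open scoped Classical in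
open SandwichSet in
/-- **Registered stub `stub_condAssocSet_sp`** (= `SandwichSet.sandwich_condAssoc_set` on `Fin n`): Corollary H —
conditional sandwich association given `{s ↮ t}` — for an observer SET. [cite: VandenbergHaggstromKahn2005, Thms. 1.1–1.5 (pp. 3–8)] -/
theorem stub_condAssocSet_sp : ∀ (n : ℕ) (w : Sym2 (Fin n) → unitInterval) (s t : Fin n) (O : Finset (Fin n)) (F : Set (Sym2 (Fin n)) → ℝ), Monotone F → ∀ (h : Set (Sym2 (Fin n)) → ℝ), (∀ C, 0 ≤ h C) → (∀ C, h C ≤ 1) → (∫ ω in {ω : BondConfig (Fin n) | ¬ (openGraph ω).Reachable s t}, F (openEdgeCluster ω s) ∂(prodBernoulli w)) * (∫ ω in {ω : BondConfig (Fin n) | ¬ (openGraph ω).Reachable s t}, (if ∃ o ∈ O, (openGraph ω).Reachable s o then (1 : ℝ) else if ∃ o ∈ O, (openGraph ω).Reachable o t then 0 else h (⋃ o ∈ O, openEdgeCluster ω o)) ∂(prodBernoulli w)) ≤ (prodBernoulli w).real {ω : BondConfig (Fin n) | ¬ (openGraph ω).Reachable s t} * ∫ ω in {ω : BondConfig (Fin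 n) | ¬ (openGraph ω).Reachable s t}, F (openEdgeCluster ω s) * (if ∃ o ∈ O, (openGraph ω).Reachable s o then (1 : ℝ) else if ∃ o ∈ O, (openGraph ω).Reachable o t then 0 else h (⋃ o ∈ O, openEdgeCluster ω o)) ∂(prodBernoulli w) :=
  fun _ w s t O F hF h h0 h1 => by
    convert sandwich_condAssoc_set w s t O F hF h h0 h1 using 3 <;>
      (funext ω; first | rfl | (split_ifs <;> rfl))

end Summit.CriticalPhenomena.PercolationContinuityZ3.Theorems
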